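/-
Origin: expansion seat `planner-pub-hodgecm-mc-sanity-1-g3-0`, handover #4 2026-08-19T00:36Z md5 7c36218a83d8488847e7301d62d1b768 (NEW, 307 l., 19 decls in namespaces HodgeCM.Model.SupplyResidual(.WeilPairData); imports HodgeCM.Model.SupplyClassLevel (theta-3-g3 t33-mctheta3g3 #1, 2497dc06b48e6c3a7b64e96f661274de) + the installed r32 HodgeCM.Model.Sanity.ClassSupplySanity; INSTALL AFTER theta-3-g3 #1; rc 0 / 0 warnings / ~6 s against overlay olean of exactly 2497dc06b (`HOME/mc/pub-hodgecm-mc-sanity-1-g3/lean/ClassSupplyLevelSanity.lean`, md5 7c36218a, 307 lines);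
landed by the gen-9 packager (p-g9) in gate run 33 as `HodgeCM/Model/Sanity/ClassSupplyLevelSanity.lean` (verbatim).
-/
/-
Origin: SANITY lane `planner-pub-hodgecm-mc-sanity-1-g3-0` (unit pub-hodgecm-mc-sanity-1-g3, gen 3 of mc-sanity-1,
nodes SAN-6b / SAN-7), 2026-08-19.  NEW additive leaf under `HodgeCM/Model/Sanity/`; imports mc-theta-3-g3's
`HodgeCM.Model.SupplyClassLevel` (RUN-33 kit `t33-mctheta3g3.txt` #1) and the INSTALLED r32 sanity leaf
`HodgeCM.Model.Sanity.ClassSupplySanity`; nothing imports it.  KERNEL: 0 records, 0 hypotheses minted, no global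
instances.  Expected `#print axioms`: ⊆ {propext, Classical.choice, Quot.sound}.
-/
import Summits.HodgeConjecture.HodgeCM.Model.SupplyClassLevel
import Summits.HodgeConjecture.HodgeCM.Model.Sanity.ClassSupplySanity

/-!
# Sanity profile of the LEVEL-INDEXED class supply records (binder `classPacks`, E rev 6)

Two kernel checks on the records behind the assembler's binder
`classPacks : ∀ V c, T.GoodCtx ι₁ c → finrank ℚ c.K = 6 → Nonempty (ClassSupplyPackN T V c 0) ∧
Nonempty (ClassSupplyPackN T V c 1)` (mc-glue-1-g3 `E2InstanceR6.lean`), re-based on mc-theta-3-g3's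
level-indexed records `WeilPairData.ClassSupplyDataAt P T V c k N` / `ClassSupplyPackN T V c k`
(`HodgeCM.Model.SupplyClassLevel`) after the carvers' ruling (J-lvl)/(J-fam) of 2026-08-19T00:20:57Z.

## § 1. Inhabitation profile (rule SAN-6 for `classPacks`)

Exactly as for the fixed-level records of RUN 32 (`Sanity/ClassSupplySanity`): over ANY pair datum `P`, one
scalar-closed line `ℂ ∙ c₀ ⊆ Θ_k(Γ₀)` with `c₀ ≠ 0` inhabits `ClassSupplyDataAt P T V c k N` for every `N ≥ 1`
(all groups and weights trivial, `𝓙 = 𝓕 = univ`, `D = lineClassMapDatum Γ_U c₀` — the constant family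
`ClassSupplyData.toAt` of gen-2's `classSupplyDataOfLine`), and the binder TYPE is equivalent to its use-site
OUTPUT:

* `nonempty_classSupplyDataAt_iff : Nonempty (∀ N, 0 < N → P.ClassSupplyDataAt T V c k N) ↔ ∃ Γ, ∃ ω ∈ Θ_k(Γ), ω ≠ 0`;
* `nonempty_classSupplyPackN_iff`, `classSupplyPackN_hypothesis_iff … ↔ T.Open_supply`, and the literal R6 shape
  `classPacksR6_iff` (with the `finrank ℚ c.K = 6` guard) — for models whose `Θ₀`, `Θ₁` are closed under scalars.

VERDICT (unchanged from gen-2 for the re-indexed binder): the type of `classPacks` is inhabited in some model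
(any model with one non-zero scalar-closed theta line), and with `D(N)`, `Θ_k` free it TRANSPORTS supply and
certifies none — its content is joint with the pin `Theta := Model.thetaOf _ I` and with the producer of the
packs (mc-theta-3-g3's `KTypeSituation.classSupplyDataAt`, `HodgeCM.Model.ThetaSpace`).

## § 2. Finding F1 in kernel form (rule SAN-6, negative half, ruling (J-lvl) item (3) / (J-lvl′) (e))

The fixed-level record `ClassSupplyData P T V c k` of RUN 32 fixes ONE `K`-type situation `(Kc, κ, σ, τ, ι)`
and asks `fam : ∀ N ≥ 1, ∃ j ∈ 𝓙, ∃ ℓ, j (ι ℓ) = φ_N`.  KERNEL consequence, from `fam` + `hι` + the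
theta-equivariance of `j` alone (`ClassSupplyData.theta_testFunT_mul_eq`):

  for every `x : Kc` with `τ x = 1` and EVERY `N ≥ 1`, the theta function of `φ_N` is right-invariant under
  `(κ x, 1)`: `Θ(ω(g · (κ x, 1)) φ_N) = Θ(ω(g) φ_N)` for all `g ∈ G_U(𝔸) × U(W_k)(𝔸)`

(concretely `thetaDist_omega_mul_testFun_eq`; the level correctors of `hΔ : IsLevelCorrected …` are such `x`,
`exists_corrector_theta_testFunT_mul_eq`).  Hence the NEGATIVE sanity theorems
`not_exists_classSupplyData_moving` / `isEmpty_classSupplyData_of_levels_move`: there is NO instance of the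
fixed-level record in which some weight-one element of `Kc` moves the theta function of some `φ_N` — in words,
no instance whose level group is an open compact `K_f(N₀)` acting genuinely on the `φ_N`, `N > N₀` (the
analytic clause «`(κ x, 1)` moves `Θ(ω(·) φ_N)`» is a HYPOTHESIS of the negative theorem, never asserted here).
For the level-indexed record the same computation (`ClassSupplyDataAt.theta_testFunT_mul_eq`) couples `Kc(N)`
with `φ_N` ONLY — consistent with `Kc(N) = K_∞ × K_f(N) ⊆ Stab(φ_N)`; this is the re-indexing's whole point.

Nothing is cited; every statement is proved from the fields of the records.
-/

set_option autoImplicit false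

noncomputable section

open MeasureTheory NumberField NumberField.mixedEmbedding
open Literature.NumberTheory.Automorphic Literature.NumberTheory.Automorphic.WeightForms
open Literature.NumberTheory.Weil1964
open HodgeCM.PerL34.SupplyAdelic HodgeCM.Model.SupplyInstance
open scoped SchwartzMap Classical

namespace HodgeCM
namespace Model
namespace SupplyResidual

/-! ## § 1. Inhabitation profile of the level-indexed records -/

namespace WeilPairData

variable {K L : Type} [Field K] [NumberField K] [Field L] [NumberField L] [Algebra K L] [FiniteDimensional K L]
variable {J : Type} [Fintype J] {GU : Type} [Group GU] [TopologicalSpace GU] [IsTopologicalGroup GU]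
  [LocallyCompactSpace GU] (P : WeilPairData K L J GU) [CompactSpace (GU ⧸ P.ΓU)]
variable {U : Universe} (T : U.ThetaModel) {Lc : CMField} {ι₁ : Lc →+* ℂ} (V : HermSpace3 Lc ι₁) (c : SeesawCtx Lc)
  (k : Fin 4)

/-- **`ClassSupplyDataAt` at every `N ≥ 1` from one line in `Θ_k(Γ₀)`** (the constant family of gen-2's degenerate
fixed-level record: all groups trivial, all weights trivial, `𝓙 = 𝓕 := univ`, `D := lineClassMapDatum Γ_U c₀`). -/
def classSupplyDataAtOfLine (Γ₀ : Level V) (c₀ : U.CohC (U.pms Lc ι₁ V Γ₀) 1) (hc₀ : c₀ ≠ 0)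
    (hline : ∀ z : ℂ, z • c₀ ∈ T.Theta V c k Γ₀) (N : ℕ) (hN : 0 < N) : P.ClassSupplyDataAt T V c k N :=
  ClassSupplyData.toAt P (P.classSupplyDataOfLine T V c k Γ₀ c₀ hc₀ hline) N hN

/-- Its `K`-type index group is the trivial group. -/
theorem classSupplyDataAtOfLine_Kc (Γ₀ : Level V) (c₀ : U.CohC (U.pms Lc ι₁ V Γ₀) 1) (hc₀ : c₀ ≠ 0)
    (hline : ∀ z : ℂ, z • c₀ ∈ T.Theta V c k Γ₀) (N : ℕ) (hN : 0 < N) :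
    (P.classSupplyDataAtOfLine T V c k Γ₀ c₀ hc₀ hline N hN).Kc = Unit := rfl

/-- One non-zero scalar-closed line in some `Θ_k(Γ)` inhabits the level-indexed record at every `N ≥ 1`. -/
theorem nonempty_classSupplyDataAt_of_line {Γ : Level V} {ω : U.CohC (U.pms Lc ι₁ V Γ) 1} (hne : ω ≠ 0)
    (hline : ∀ z : ℂ, z • ω ∈ T.Theta V c k Γ) (N : ℕ) (hN : 0 < N) : Nonempty (P.ClassSupplyDataAt T V c k N) :=
  ⟨P.classSupplyDataAtOfLine T V c k Γ ω hne hline N hN⟩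

/-- **The level-indexed family is exactly as strong as its output** for a scalar-closed `Θ_k`, over EVERY pair
datum `P`: `→` is mc-theta-3-g3's kernel `supply_of_classSupplyDataAt`, `←` is the constant degenerate family. -/
theorem nonempty_classSupplyDataAt_iff
    (hΘ : ∀ (Γ : Level V) (z : ℂ) (ω : U.CohC (U.pms Lc ι₁ V Γ) 1), ω ∈ T.Theta V c k Γ → z • ω ∈ T.Theta V c k Γ) :
    Nonempty (∀ N : ℕ, 0 < N → P.ClassSupplyDataAt T V c k N) ↔ ∃ Γ : Level V, ∃ ω ∈ T.Theta V c k Γ, ω ≠ 0 :=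
  ⟨fun ⟨S⟩ => P.supply_of_classSupplyDataAt S, fun ⟨Γ, ω, hω, hne⟩ =>
    ⟨P.classSupplyDataAtOfLine T V c k Γ ω hne fun z => hΘ Γ z ω hω⟩⟩

end WeilPairData

section Pack

variable {K : Type} [Field K] [NumberField K] {J : Type} [Fintype J]
variable {U : Universe} (T : U.ThetaModel) {Lc : CMField} {ι₁ : Lc →+* ℂ} (V : HermSpace3 Lc ι₁) (c : SeesawCtx Lc)
  (k : Fin 4)

/-- **`ClassSupplyPackN` from one line in `Θ_k(Γ₀)`**: gen-2's degenerate fixed-level pack (carriers `L := K`,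
`G_U := Unit`, the trivial pair datum of `Sanity/SupplyPairSanity`), re-indexed by `ClassSupplyPack.toN`. -/
def classSupplyPackNOfLine (Φinf : 𝓢((J → mixedSpace K), ℂ)) (x₀ : J → K) (hx₀ : Φinf (archEmb K J x₀) ≠ 0)
    (Γ₀ : Level V) (c₀ : U.CohC (U.pms Lc ι₁ V Γ₀) 1) (hc₀ : c₀ ≠ 0)
    (hline : ∀ z : ℂ, z • c₀ ∈ T.Theta V c k Γ₀) : ClassSupplyPackN T V c k :=
  (classSupplyPackOfLine T V c k Φinf x₀ hx₀ Γ₀ c₀ hc₀ hline).toN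

/-- **The level-indexed class supply pack is exactly as strong as its output** (scalar-closed `Θ_k`, one
archimedean test function non-vanishing at a rational point). -/
theorem nonempty_classSupplyPackN_iff (Φinf : 𝓢((J → mixedSpace K), ℂ)) (x₀ : J → K)
    (hx₀ : Φinf (archEmb K J x₀) ≠ 0)
    (hΘ : ∀ (Γ : Level V) (z : ℂ) (ω : U.CohC (U.pms Lc ι₁ V Γ) 1), ω ∈ T.Theta V c k Γ → z • ω ∈ T.Theta V c k Γ) :
    Nonempty (ClassSupplyPackN T V c k) ↔ ∃ Γ : Level V, ∃ ω ∈ T.Theta V c k Γ, ω ≠ 0 :=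
  ⟨fun ⟨S⟩ => S.P.supply_of_classSupplyDataAt S.cls, fun ⟨Γ, ω, hω, hne⟩ =>
    ⟨classSupplyPackNOfLine T V c k Φinf x₀ hx₀ Γ ω hne fun z => hΘ Γ z ω hω⟩⟩

/-- Hence the hypothesis of mc-theta-3-g3's `open_supply_of_classSupplyPackN` is EQUIVALENT to its conclusion
`T.Open_supply` (for a model whose `Θ₀`, `Θ₁` are scalar-closed). -/
theorem classSupplyPackN_hypothesis_iff (Φinf : 𝓢((J → mixedSpace K), ℂ)) (x₀ : J → K)
    (hx₀ : Φinf (archEmb K J x₀) ≠ 0)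
    (hΘ : ∀ {Lc : CMField} {ι₁ : Lc →+* ℂ} (V : HermSpace3 Lc ι₁) (c : SeesawCtx Lc) (k : Fin 4) (Γ : Level V)
      (z : ℂ) (ω : U.CohC (U.pms Lc ι₁ V Γ) 1), ω ∈ T.Theta V c k Γ → z • ω ∈ T.Theta V c k Γ) :
    (∀ {Lc : CMField} {ι₁ : Lc →+* ℂ} (V : HermSpace3 Lc ι₁) (c : SeesawCtx Lc), T.GoodCtx ι₁ c →
        Nonempty (ClassSupplyPackN T V c 0) ∧ Nonempty (ClassSupplyPackN T V c 1)) ↔ T.Open_supply := by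
  refine ⟨fun H Lc ι₁ V c hc => ?_, fun H Lc ι₁ V c hc => ?_⟩
  · exact ⟨(nonempty_classSupplyPackN_iff T V c 0 Φinf x₀ hx₀ (hΘ V c 0)).mp (H V c hc).1,
      (nonempty_classSupplyPackN_iff T V c 1 Φinf x₀ hx₀ (hΘ V c 1)).mp (H V c hc).2⟩
  · exact ⟨(nonempty_classSupplyPackN_iff T V c 0 Φinf x₀ hx₀ (hΘ V c 0)).mpr (H V c hc).1,
      (nonempty_classSupplyPackN_iff T V c 1 Φinf x₀ hx₀ (hΘ V c 1)).mpr (H V c hc).2⟩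

/-- **The literal R6 binder shape ≡ its use-site output.**  The assembler's `classPacks` (with the sextic guard
`finrank ℚ c.K = 6`) holds iff both type indices `0, 1` are supplied in every guarded good context — which is all
`E2InstanceR6` extracts from it (`S.toPairSupplyData.toLineSupplyData.D.supply …res`). -/
theorem classPacksR6_iff (Φinf : 𝓢((J → mixedSpace K), ℂ)) (x₀ : J → K) (hx₀ : Φinf (archEmb K J x₀) ≠ 0)
    (hΘ : ∀ {Lc : CMField} {ι₁ : Lc →+* ℂ} (V : HermSpace3 Lc ι₁) (c : SeesawCtx Lc) (k : Fin 4) (Γ : Level V)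
      (z : ℂ) (ω : U.CohC (U.pms Lc ι₁ V Γ) 1), ω ∈ T.Theta V c k Γ → z • ω ∈ T.Theta V c k Γ) :
    (∀ {Lc : CMField} {ι₁ : Lc →+* ℂ} (V : HermSpace3 Lc ι₁) (c : SeesawCtx Lc), T.GoodCtx ι₁ c →
        Module.finrank ℚ c.K = 6 → Nonempty (ClassSupplyPackN T V c 0) ∧ Nonempty (ClassSupplyPackN T V c 1)) ↔
      ∀ {Lc : CMField} {ι₁ : Lc →+* ℂ} (V : HermSpace3 Lc ι₁) (c : SeesawCtx Lc), T.GoodCtx ι₁ c →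
        Module.finrank ℚ c.K = 6 →
          (∃ Γ : Level V, ∃ ω ∈ T.Theta V c 0 Γ, ω ≠ 0) ∧ ∃ Γ : Level V, ∃ ω ∈ T.Theta V c 1 Γ, ω ≠ 0 := by
  refine ⟨fun H Lc ι₁ V c hc hK => ?_, fun H Lc ι₁ V c hc hK => ?_⟩
  · exact ⟨(nonempty_classSupplyPackN_iff T V c 0 Φinf x₀ hx₀ (hΘ V c 0)).mp (H V c hc hK).1,
      (nonempty_classSupplyPackN_iff T V c 1 Φinf x₀ hx₀ (hΘ V c 1)).mp (H V c hc hK).2⟩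
  · exact ⟨(nonempty_classSupplyPackN_iff T V c 0 Φinf x₀ hx₀ (hΘ V c 0)).mpr (H V c hc hK).1,
      (nonempty_classSupplyPackN_iff T V c 1 Φinf x₀ hx₀ (hΘ V c 1)).mpr (H V c hc hK).2⟩

end Pack

/-! ## § 2. Finding F1 in kernel form: the fixed-level record forces level-invariance of EVERY `Θ(ω(·) φ_N)` -/

namespace WeilPairData

variable {K L : Type} [Field K] [NumberField K] [Field L] [NumberField L] [Algebra K L] [FiniteDimensional K L]
variable {J : Type} [Fintype J] {GU : Type} [Group GU] [TopologicalSpace GU] [IsTopologicalGroup GU]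
  [LocallyCompactSpace GU] (P : WeilPairData K L J GU) [CompactSpace (GU ⧸ P.ΓU)]
variable {U : Universe} {T : U.ThetaModel} {Lc : CMField} {ι₁ : Lc →+* ℂ} {V : HermSpace3 Lc ι₁} {c : SeesawCtx Lc}
  {k : Fin 4}

omit [CompactSpace (GU ⧸ P.ΓU)] in
/-- The section `s` of the pair's kernel datum is the identity of `G_U(𝔸) × U(W_k)(𝔸)`. -/
theorem kernelDatum_s_apply (g : GU × relNormOneIdeles K L) : P.kernelDatum.s g = g := rfl

omit [CompactSpace (GU ⧸ P.ΓU)] in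
/-- The theta function of `φ_N` in the pair's kernel datum IS `g ↦ Θ(ω(g) φ_N)`. -/
theorem kernelDatum_theta_testFunT (N : ℕ) (g : GU × relNormOneIdeles K L) :
    P.kernelDatum.W.theta (P.testFunT N) g = thetaDistLM K J (P.ω g (testFun K J P.Φinf P.x₀ N)) := rfl

/-- **F1, kernel form (fixed-level record).**  In ANY instance of `ClassSupplyData P T V c k`, every weight-one
element `x : Kc` (`τ x = 1`) fixes the theta function of EVERY `φ_N`, `N ≥ 1`, on the right:
`Θ_{φ_N}(g · s(κ x, 1)) = Θ_{φ_N}(g)`.  Proof: `fam` writes `φ_N = j (ι ℓ)`; `τ x = 1` gives `τ^∨ x ℓ = ℓ`, so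
`hι` gives `σ x (ι ℓ) = ι ℓ`; theta-equivariance of `j` at `(x, ι ℓ)` is the claim. -/
theorem ClassSupplyData.theta_testFunT_mul_eq (S : P.ClassSupplyData T V c k) {x : S.Kc} (hx : S.τ x = 1)
    {N : ℕ} (hN : 0 < N) (g : GU × relNormOneIdeles K L) :
    P.kernelDatum.W.theta (P.testFunT N) (g * P.kernelDatum.s (S.κ x, 1)) =
      P.kernelDatum.W.theta (P.testFunT N) g := by
  obtain ⟨j, -, ℓ, hjℓ⟩ := S.fam N hN
  have hx' : S.τ x⁻¹ = 1 := by
    have h := map_mul S.τ x⁻¹ x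
    rwa [inv_mul_cancel, map_one, hx, mul_one, eq_comm] at h
  have hdual : S.τ.dual x ℓ = ℓ := by
    rw [Representation.dual_apply, hx', Module.Dual.transpose_apply]
    exact LinearMap.comp_id ℓ
  have hfix : S.σ x (S.ι ℓ) = S.ι ℓ := by rw [← S.hι x ℓ, hdual]
  have h := j.2 x (S.ι ℓ) g
  rw [hfix] at h
  rw [← hjℓ]
  exact h.symm

/-- The same, concretely: `Θ(ω(g · (κ x, 1)) φ_N) = Θ(ω(g) φ_N)` for all `g`, all `N ≥ 1`, all weight-one `x`. -/
theorem ClassSupplyData.thetaDist_omega_mul_testFun_eq (S : P.ClassSupplyData T V c k) {x : S.Kc}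
    (hx : S.τ x = 1) {N : ℕ} (hN : 0 < N) (g : GU × relNormOneIdeles K L) :
    thetaDistLM K J (P.ω (g * (S.κ x, 1)) (testFun K J P.Φinf P.x₀ N)) =
      thetaDistLM K J (P.ω g (testFun K J P.Φinf P.x₀ N)) :=
  S.theta_testFunT_mul_eq P hx hN g

/-- In particular at `g = 1`: the theta DISTRIBUTION does not see the translate `ω(κ x, 1) φ_N`. -/
theorem ClassSupplyData.thetaDist_omega_testFun_eq (S : P.ClassSupplyData T V c k) {x : S.Kc}
    (hx : S.τ x = 1) {N : ℕ} (hN : 0 < N) :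
    thetaDistLM K J (P.ω (S.κ x, 1) (testFun K J P.Φinf P.x₀ N)) =
      thetaDistLM K J (testFun K J P.Φinf P.x₀ N) := by
  simpa only [one_mul, map_one, Module.End.one_apply] using S.thetaDist_omega_mul_testFun_eq P hx hN 1

/-- **F1 through the level correction.**  For every arithmetic element `δ ∈ Δ`, the corrector `c_δ : Kc` of
`hΔ : IsLevelCorrected Γ_U κ τ ιinf Δ` (`τ c_δ = 1`, `ιinf δ · κ c_δ ∈ Γ_U`) fixes the theta function of every
`φ_N` — one corrector for ALL `N ≥ 1`, which is what a level `K_f(N₀)` genuinely moving the `φ_N`, `N > N₀`,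
cannot do. -/
theorem ClassSupplyData.exists_corrector_theta_testFunT_mul_eq (S : P.ClassSupplyData T V c k) {δ : S.G₁}
    (hδ : δ ∈ S.Δ) :
    ∃ cδ : S.Kc, S.τ cδ = 1 ∧ S.ιinf δ * S.κ cδ ∈ P.ΓU ∧ ∀ N : ℕ, 0 < N → ∀ g : GU × relNormOneIdeles K L,
      P.kernelDatum.W.theta (P.testFunT N) (g * P.kernelDatum.s (S.κ cδ, 1)) =
        P.kernelDatum.W.theta (P.testFunT N) g := by
  obtain ⟨cδ, hτ, hΓ, -⟩ := S.hΔ δ hδ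
  exact ⟨cδ, hτ, hΓ, fun N hN g => S.theta_testFunT_mul_eq P hτ hN g⟩

/-- **F1, kernel form (level-indexed record).**  In an instance of `ClassSupplyDataAt P T V c k N` the same
computation couples the `K`-type group OF INDEX `N` with `φ_N` only: `Θ_{φ_N}(g · s(κ_N x, 1)) = Θ_{φ_N}(g)` for
the weight-one `x : Kc(N)` — no constraint across levels. -/
theorem ClassSupplyDataAt.theta_testFunT_mul_eq {N : ℕ} (S : P.ClassSupplyDataAt T V c k N) {x : S.Kc}
    (hx : S.τ x = 1) (g : GU × relNormOneIdeles K L) :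
    P.kernelDatum.W.theta (P.testFunT N) (g * P.kernelDatum.s (S.κ x, 1)) =
      P.kernelDatum.W.theta (P.testFunT N) g := by
  obtain ⟨j, -, ℓ, hjℓ⟩ := S.fam
  have hx' : S.τ x⁻¹ = 1 := by
    have h := map_mul S.τ x⁻¹ x
    rwa [inv_mul_cancel, map_one, hx, mul_one, eq_comm] at h
  have hdual : S.τ.dual x ℓ = ℓ := by
    rw [Representation.dual_apply, hx', Module.Dual.transpose_apply]
    exact LinearMap.comp_id ℓ
  have hfix : S.σ x (S.ι ℓ) = S.ι ℓ := by rw [← S.hι x ℓ, hdual]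
  have h := j.2 x (S.ι ℓ) g
  rw [hfix] at h
  rw [← hjℓ]
  exact h.symm

/-! ### The negative sanity theorems against the fixed-level record -/

/-- **No instance of the fixed-level record moves a theta function of a test function by a weight-one element**:
`¬ ∃ S, ∃ x : S.Kc, τ x = 1 ∧ ∃ N ≥ 1, ∃ g, Θ_{φ_N}(g · s(κ x, 1)) ≠ Θ_{φ_N}(g)`. -/
theorem not_exists_classSupplyData_moving :
    ¬ ∃ S : P.ClassSupplyData T V c k, ∃ x : S.Kc, S.τ x = 1 ∧ ∃ N : ℕ, 0 < N ∧
      ∃ g : GU × relNormOneIdeles K L,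
        P.kernelDatum.W.theta (P.testFunT N) (g * P.kernelDatum.s (S.κ x, 1)) ≠
          P.kernelDatum.W.theta (P.testFunT N) g := by
  rintro ⟨S, x, hx, N, hN, g, hne⟩
  exact hne (S.theta_testFunT_mul_eq P hx hN g)

/-- **The fixed-level record is EMPTY as soon as, in every candidate instance, some weight-one element of the
`K`-type group moves the theta function of some `φ_N`** — the kernel form of «no instance whose level is an open
compact `K_f(N₀)` acting genuinely on the `φ_N`, `N > N₀`» (the analytic clause is the hypothesis `hmove`; it is
not asserted in this package). -/
theorem isEmpty_classSupplyData_of_levels_move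
    (hmove : ∀ S : P.ClassSupplyData T V c k, ∃ x : S.Kc, S.τ x = 1 ∧ ∃ N : ℕ, 0 < N ∧
      ∃ g : GU × relNormOneIdeles K L,
        thetaDistLM K J (P.ω (g * (S.κ x, 1)) (testFun K J P.Φinf P.x₀ N)) ≠
          thetaDistLM K J (P.ω g (testFun K J P.Φinf P.x₀ N))) :
    IsEmpty (P.ClassSupplyData T V c k) :=
  ⟨fun S => by
    obtain ⟨x, hx, N, hN, g, hne⟩ := hmove S
    exact hne (S.thetaDist_omega_mul_testFun_eq P hx hN g)⟩

/-- The same through the level correction: if in every candidate instance some arithmetic `δ ∈ Δ` has ALL its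
`Γ_U`-correctors of weight one moving some `Θ(ω(·) φ_N)`, the fixed-level record is empty. -/
theorem isEmpty_classSupplyData_of_correctors_move
    (hmove : ∀ S : P.ClassSupplyData T V c k, ∃ δ ∈ S.Δ, ∀ cδ : S.Kc, S.τ cδ = 1 → S.ιinf δ * S.κ cδ ∈ P.ΓU →
      ∃ N : ℕ, 0 < N ∧ ∃ g : GU × relNormOneIdeles K L,
        thetaDistLM K J (P.ω (g * (S.κ cδ, 1)) (testFun K J P.Φinf P.x₀ N)) ≠
          thetaDistLM K J (P.ω g (testFun K J P.Φinf P.x₀ N))) :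
    IsEmpty (P.ClassSupplyData T V c k) :=
  ⟨fun S => by
    obtain ⟨δ, hδ, h⟩ := hmove S
    obtain ⟨cδ, hτ, hΓ, -⟩ := S.hΔ δ hδ
    obtain ⟨N, hN, g, hne⟩ := h cδ hτ hΓ
    exact hne (S.thetaDist_omega_mul_testFun_eq P hτ hN g)⟩

/-- Consistency: in the degenerate instance of § 1 (`Kc = Unit`, `κ = 1`) the forced invariance is `g · 1 = g`,
so the hypothesis `hmove` of the negative theorems fails there — they bite only on instances whose level group
acts genuinely, as intended. -/
theorem not_moving_classSupplyDataOfLine (T : U.ThetaModel) (V : HermSpace3 Lc ι₁) (c : SeesawCtx Lc) (k : Fin 4)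
    (Γ₀ : Level V) (c₀ : U.CohC (U.pms Lc ι₁ V Γ₀) 1) (hc₀ : c₀ ≠ 0) (hline : ∀ z : ℂ, z • c₀ ∈ T.Theta V c k Γ₀)
    (x : (P.classSupplyDataOfLine T V c k Γ₀ c₀ hc₀ hline).Kc) (N : ℕ) (g : GU × relNormOneIdeles K L) :
    thetaDistLM K J (P.ω (g * ((P.classSupplyDataOfLine T V c k Γ₀ c₀ hc₀ hline).κ x, 1))
        (testFun K J P.Φinf P.x₀ N)) =
      thetaDistLM K J (P.ω g (testFun K J P.Φinf P.x₀ N)) := by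
  have hκ : (P.classSupplyDataOfLine T V c k Γ₀ c₀ hc₀ hline).κ x = 1 := rfl
  rw [hκ, Prod.mk_one_one, mul_one]

end WeilPairData

end SupplyResidual
end Model
end HodgeCM

end
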